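import Mathlib

/-!
# T5UnitaryBound — the CLAIM of (N4.3.P1) for every `g ∈ U(1,1)`, without the Cartan decomposition

Blind cell `pub-hodge-repro2`, seat p1 (gen 6), Tier-5 support for route/T5-N4-p5.md (N4.3 = (R3),
owner p5).  Uses an L-value-free non-vanishing device: **no** (this file is a matrix identity).

The CLAIM of (N4.3.P1) reads: `|a(i(g,1))| = det((1 + g g*)/2)^(−1/2) ≤ 1` for every
`g ∈ U(W)(ℝ) = U(1,1)`, with equality iff `g ∈ K_W = U(1) × U(1)`.  The text proves it through the
Cartan decomposition `g = k₁ a_t k₂` and the identity `det((1 + a_t a_tᵀ)/2) = cosh² t`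
(kernel row L2, `T5DoublingBlock.det_half_one_add_hyperbolic`).  Here the same quantity is computed
for EVERY `g` directly from the two relation sets of `U(1,1)`:

* `Delta_eq` : `det(½(1 + g gᴴ)) = 1 + |g₂₁|²` (and `= 1 + |g₁₂|²`, `Delta_eq'`), an exact identity;
* hence `1 ≤ Δ(g)` (`one_le_Delta_re`), `Δ(g)` real (`Delta_im`), and
  `Δ(g) = 1 ⟺ g gᴴ = 1 ⟺ g ∈ U(2)` (`Delta_eq_one_iff_mul_conjTranspose`,
  `Delta_eq_one_iff_mem_unitaryGroup`) — the «equality iff `g ∈ K_W`» clause;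
* `|det g| = 1` (`normSq_det`, `norm_det`);
* the bound `|a(i(g,1))| = Δ(g)^(−1/2) ≤ 1` (`aNorm_le_one`) with equality iff `g gᴴ = 1`
  (`aNorm_eq_one_iff`), and the pointwise ε-bound `Δ^(−(r − ½)/2) ≤ Δ^(ε/2)` for `r ≥ ½ − ε`
  (`rpow_exponent_bound`) used for the half-plane of absolute convergence;
* consistency with L2: the complexified hyperbolic matrix `a_t` lies in `U(1,1)` and the identity
  returns `cosh² t` (`Delta_hyperbolicC`).

Conventions: `J = diag(1, −1)`; `g ∈ U(1,1)` means `gᴴ J g = J` (`MemU11`); the other relation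
`g J gᴴ = J` is derived (`mul_J_mul_conjTranspose`, via `mul_eq_one_comm`).

Not formalised (honest scope): the Cartan decomposition itself (not needed for the CLAIM once the
identity holds for all `g`), the Haar measure of `U(1,1)` in Cartan coordinates (the `sinh(2t) dt`
Jacobian of the convergence integral), the parabolic `P(Y_n)`, the standard section, and anything
representation-theoretic.  Mathlib only; no `sorry`; axioms ⊆ {propext, Classical.choice, Quot.sound}.
-/

namespace Summit.Ventures.HodgeRepro2.T5UnitaryBound

open Matrix Complex
open scoped Matrix ComplexConjugate

/-- The hermitian form of signature `(1,1)` on `ℂ²`: `J = diag(1, −1)`. -/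
def J : Matrix (Fin 2) (Fin 2) ℂ := !![1, 0; 0, -1]

/-- Membership in `U(1,1) = U(J)`: `gᴴ J g = J`. -/
def MemU11 (g : Matrix (Fin 2) (Fin 2) ℂ) : Prop := gᴴ * J * g = J

/-- `Δ(g) := det(½(1 + g gᴴ))`, the quantity of the CLAIM of (N4.3.P1): `|a(i(g,1))| = Δ(g)^(−1/2)`. -/
noncomputable def Delta (g : Matrix (Fin 2) (Fin 2) ℂ) : ℂ := det ((1 / 2 : ℂ) • (1 + g * gᴴ))

/-- The `(0,0)` entry of `J`. -/
@[simp] lemma J_apply_zero_zero : J 0 0 = 1 := by simp [J]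
/-- The `(0,1)` entry of `J`. -/
@[simp] lemma J_apply_zero_one : J 0 1 = 0 := by simp [J]
/-- The `(1,0)` entry of `J`. -/
@[simp] lemma J_apply_one_zero : J 1 0 = 0 := by simp [J]
/-- The `(1,1)` entry of `J`. -/
@[simp] lemma J_apply_one_one : J 1 1 = -1 := by simp [J]

/-- `J² = 1`. -/
lemma J_mul_J : J * J = 1 := by
  ext i j
  fin_cases i <;> fin_cases j <;> simp [Matrix.mul_apply, Fin.sum_univ_two]

/-- `det J = −1`. -/
lemma det_J : det J = -1 := by
  rw [Matrix.det_fin_two]; simp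

section relations

variable {g : Matrix (Fin 2) (Fin 2) ℂ}

/-- The second relation set of `U(1,1)`: `g J gᴴ = J` (from `gᴴ J g = J`, `J² = 1` and the fact that
a one-sided inverse of a square matrix is two-sided). -/
lemma mul_J_mul_conjTranspose (hg : MemU11 g) : g * J * gᴴ = J := by
  have h1 : (J * gᴴ * J) * g = 1 := by
    calc (J * gᴴ * J) * g = J * (gᴴ * J * g) := by simp only [Matrix.mul_assoc]
      _ = J * J := by rw [hg]
      _ = 1 := J_mul_J
  have h2 : g * (J * gᴴ * J) = 1 := mul_eq_one_comm.mp h1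
  calc g * J * gᴴ = g * J * gᴴ * (J * J) := by rw [J_mul_J, Matrix.mul_one]
    _ = (g * (J * gᴴ * J)) * J := by simp only [Matrix.mul_assoc]
    _ = J := by rw [h2, Matrix.one_mul]

/-- Column relations, entry by entry: `conj(g₀ᵢ) g₀ⱼ − conj(g₁ᵢ) g₁ⱼ = Jᵢⱼ`. -/
lemma col_rel (hg : MemU11 g) (i j : Fin 2) :
    conj (g 0 i) * g 0 j - conj (g 1 i) * g 1 j = J i j := by
  have h := congrFun (congrFun hg i) j
  simp only [Matrix.mul_apply, Fin.sum_univ_two, Matrix.conjTranspose_apply, Complex.star_def,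
    J_apply_zero_zero, J_apply_zero_one, J_apply_one_zero, J_apply_one_one] at h
  linear_combination h

/-- Row relations, entry by entry: `gᵢ₀ conj(gⱼ₀) − gᵢ₁ conj(gⱼ₁) = Jᵢⱼ`. -/
lemma row_rel (hg : MemU11 g) (i j : Fin 2) :
    g i 0 * conj (g j 0) - g i 1 * conj (g j 1) = J i j := by
  have h := congrFun (congrFun (mul_J_mul_conjTranspose hg) i) j
  simp only [Matrix.mul_apply, Fin.sum_univ_two, Matrix.conjTranspose_apply, Complex.star_def,
    J_apply_zero_zero, J_apply_zero_one, J_apply_one_zero, J_apply_one_one] at h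
  linear_combination h

/-- `|g₀₁|² = |g₁₀|²` on `U(1,1)` (from the `(0,0)` row and column relations). -/
lemma normSq_offdiag (hg : MemU11 g) : normSq (g 0 1) = normSq (g 1 0) := by
  have r1 := row_rel hg 0 0
  have c1 := col_rel hg 0 0
  simp only [J_apply_zero_zero] at r1 c1
  have : (normSq (g 0 1) : ℂ) = normSq (g 1 0) := by
    rw [Complex.normSq_eq_conj_mul_self, Complex.normSq_eq_conj_mul_self]
    linear_combination c1 - r1
  exact_mod_cast this

/-- THE IDENTITY: `det(½(1 + g gᴴ)) = 1 + |g₁₀|²` for every `g ∈ U(1,1)`. -/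
theorem Delta_eq (hg : MemU11 g) : Delta g = 1 + (normSq (g 1 0) : ℂ) := by
  have r1 := row_rel hg 0 0
  have r2 := row_rel hg 1 1
  have r3 := row_rel hg 0 1
  have r4 := row_rel hg 1 0
  simp only [J_apply_zero_zero, J_apply_one_one, J_apply_zero_one, J_apply_one_zero] at r1 r2 r3 r4
  unfold Delta
  rw [Matrix.det_smul, Fintype.card_fin, Matrix.det_fin_two, Complex.normSq_eq_conj_mul_self]
  simp only [Matrix.add_apply, Matrix.one_apply, Matrix.mul_apply, Fin.sum_univ_two,
    Matrix.conjTranspose_apply, Complex.star_def, Fin.isValue, if_true, Fin.zero_eq_one_iff,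
    Fin.one_eq_zero_iff, OfNat.ofNat_ne_one, if_false]
  linear_combination (1 / 4 : ℂ) *
    ((2 + 2 * (g 1 0 * conj (g 1 0)) - (g 1 0 * conj (g 1 0) - g 1 1 * conj (g 1 1) + 1)) * r1
      + (2 * (g 0 1 * conj (g 0 1)) - 2) * r2
      - 2 * (g 1 1 * conj (g 0 1)) * r3
      - (2 * (g 0 1 * conj (g 1 1)) + (g 0 0 * conj (g 1 0) - g 0 1 * conj (g 1 1))) * r4)

/-- The same identity read on the other off-diagonal entry. -/
theorem Delta_eq' (hg : MemU11 g) : Delta g = 1 + (normSq (g 0 1) : ℂ) := by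
  rw [Delta_eq hg, normSq_offdiag hg]

/-- `Δ(g)` is real: its real part is `1 + |g₁₀|²`. -/
lemma Delta_re (hg : MemU11 g) : (Delta g).re = 1 + normSq (g 1 0) := by
  rw [Delta_eq hg]; simp

/-- `Δ(g)` is real: its imaginary part vanishes. -/
lemma Delta_im (hg : MemU11 g) : (Delta g).im = 0 := by
  rw [Delta_eq hg]; simp

/-- `Δ(g) ≥ 1` for every `g ∈ U(1,1)` — the bound of the CLAIM for general `g`. -/
theorem one_le_Delta_re (hg : MemU11 g) : 1 ≤ (Delta g).re := by
  rw [Delta_re hg]; linarith [Complex.normSq_nonneg (g 1 0)]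

/-- `Δ(g) = 1` iff both off-diagonal entries vanish. -/
theorem Delta_eq_one_iff_offdiag (hg : MemU11 g) : Delta g = 1 ↔ g 0 1 = 0 ∧ g 1 0 = 0 := by
  constructor
  · intro h
    have h10 : normSq (g 1 0) = 0 := by
      have h' := Delta_re hg
      rw [h, Complex.one_re] at h'
      linarith
    have h01 : normSq (g 0 1) = 0 := by rw [normSq_offdiag hg, h10]
    exact ⟨Complex.normSq_eq_zero.mp h01, Complex.normSq_eq_zero.mp h10⟩
  · rintro ⟨-, h10⟩
    rw [Delta_eq hg, h10]; simp

/-- On `U(1,1)`: `g gᴴ = 1` iff both off-diagonal entries vanish (i.e. `K_W = U(1,1) ∩ U(2)` is the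
diagonal torus `U(1) × U(1)`). -/
theorem mul_conjTranspose_eq_one_iff (hg : MemU11 g) :
    g * gᴴ = 1 ↔ g 0 1 = 0 ∧ g 1 0 = 0 := by
  have r1 := row_rel hg 0 0
  have r2 := row_rel hg 1 1
  have r3 := row_rel hg 0 1
  have r4 := row_rel hg 1 0
  simp only [J_apply_zero_zero, J_apply_one_one, J_apply_zero_one, J_apply_one_zero] at r1 r2 r3 r4
  constructor
  · intro h
    have h00 := congrFun (congrFun h 0) 0
    have h11 := congrFun (congrFun h 1) 1
    simp only [Matrix.mul_apply, Fin.sum_univ_two, Matrix.conjTranspose_apply, Complex.star_def,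
      Matrix.one_apply_eq] at h00 h11
    have e01 : (normSq (g 0 1) : ℂ) = 0 := by
      rw [Complex.normSq_eq_conj_mul_self]; linear_combination (1 / 2 : ℂ) * (h00 - r1)
    have e10 : (normSq (g 1 0) : ℂ) = 0 := by
      rw [Complex.normSq_eq_conj_mul_self]; linear_combination (1 / 2 : ℂ) * (h11 + r2)
    exact ⟨Complex.normSq_eq_zero.mp (by exact_mod_cast e01),
      Complex.normSq_eq_zero.mp (by exact_mod_cast e10)⟩
  · rintro ⟨h01, h10⟩
    rw [h01] at r1
    rw [h10] at r2
    ext i j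
    fin_cases i <;> fin_cases j
    · simp only [Matrix.mul_apply, Fin.sum_univ_two, Matrix.conjTranspose_apply, Complex.star_def,
        Matrix.one_apply_eq, Fin.zero_eta, Fin.isValue, h01, map_zero, mul_zero, add_zero]
      linear_combination r1
    · simp [Matrix.mul_apply, Fin.sum_univ_two, h01, h10]
    · simp [Matrix.mul_apply, Fin.sum_univ_two, h01, h10]
    · simp only [Matrix.mul_apply, Fin.sum_univ_two, Matrix.conjTranspose_apply, Complex.star_def,
        Matrix.one_apply_eq, Fin.mk_one, Fin.isValue, h10, map_zero, mul_zero, zero_add]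
      linear_combination (-1 : ℂ) * r2

/-- The «equality iff `g ∈ K_W`» clause of the CLAIM: `Δ(g) = 1 ⟺ g gᴴ = 1`. -/
theorem Delta_eq_one_iff_mul_conjTranspose (hg : MemU11 g) : Delta g = 1 ↔ g * gᴴ = 1 := by
  rw [Delta_eq_one_iff_offdiag hg, mul_conjTranspose_eq_one_iff hg]

/-- The same, with `K_W = U(1,1) ∩ U(2)` written through Mathlib's `Matrix.unitaryGroup`. -/
theorem Delta_eq_one_iff_mem_unitaryGroup (hg : MemU11 g) :
    Delta g = 1 ↔ g ∈ Matrix.unitaryGroup (Fin 2) ℂ := by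
  rw [Matrix.mem_unitaryGroup_iff, Matrix.star_eq_conjTranspose]
  exact Delta_eq_one_iff_mul_conjTranspose hg

/-- `|det g|² = 1` on `U(1,1)`. -/
theorem normSq_det (hg : MemU11 g) : normSq (det g) = 1 := by
  have h := congrArg det hg
  rw [Matrix.det_mul, Matrix.det_mul, Matrix.det_conjTranspose, det_J, Complex.star_def] at h
  have : (normSq (det g) : ℂ) = 1 := by
    rw [Complex.normSq_eq_conj_mul_self]; linear_combination -h
  exact_mod_cast this

/-- `|det g| = 1` on `U(1,1)`. -/
theorem norm_det (hg : MemU11 g) : ‖det g‖ = 1 := by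
  have h := normSq_det hg
  rw [Complex.normSq_eq_norm_sq] at h
  have h0 : 0 ≤ ‖det g‖ := norm_nonneg _
  nlinarith [h, h0]

end relations

section bound

variable {g : Matrix (Fin 2) (Fin 2) ℂ}

/-- `|a(i(g,1))| := Δ(g)^(−1/2)` (real, since `Δ(g)` is real and `≥ 1`). -/
noncomputable def aNorm (g : Matrix (Fin 2) (Fin 2) ℂ) : ℝ := (Delta g).re ^ (-(1 / 2 : ℝ))

/-- The CLAIM's bound for every `g ∈ U(1,1)`: `|a(i(g,1))| ≤ 1`. -/
theorem aNorm_le_one (hg : MemU11 g) : aNorm g ≤ 1 :=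
  Real.rpow_le_one_of_one_le_of_nonpos (one_le_Delta_re hg) (by norm_num)

/-- `|a(i(g,1))| > 0`. -/
theorem aNorm_pos (hg : MemU11 g) : 0 < aNorm g :=
  Real.rpow_pos_of_pos (by linarith [one_le_Delta_re hg]) _

/-- Equality in the CLAIM's bound holds exactly on `K_W`: `|a(i(g,1))| = 1 ⟺ g gᴴ = 1`. -/
theorem aNorm_eq_one_iff (hg : MemU11 g) : aNorm g = 1 ↔ g * gᴴ = 1 := by
  rw [← Delta_eq_one_iff_mul_conjTranspose hg]
  have hre := Delta_re hg
  have him := Delta_im hg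
  have h1 := one_le_Delta_re hg
  constructor
  · intro h
    have hx : (Delta g).re = 1 := by
      have h0 : 0 ≤ (Delta g).re := by linarith
      calc (Delta g).re = ((Delta g).re ^ (-(1 / 2 : ℝ))) ^ (-(2 : ℝ)) := by
            rw [← Real.rpow_mul h0]; norm_num
        _ = 1 := by rw [← aNorm, h, Real.one_rpow]
    exact Complex.ext hx (by rw [him]; simp)
  · intro h
    unfold aNorm
    rw [h]; simp

/-- The pointwise ε-bound of the convergence argument: for `Δ ≥ 1` and `Re s = r ≥ ½ − ε`,
`Δ^(−(r − ½)/2) ≤ Δ^(ε/2)`; so `|a(i(g,1))|^(Re s − ½) ≤ Δ(g)^(ε/2)` on the half-plane. -/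
theorem rpow_exponent_bound {Δ r ε : ℝ} (hΔ : 1 ≤ Δ) (hr : 1 / 2 - ε ≤ r) :
    Δ ^ (-(r - 1 / 2) / 2) ≤ Δ ^ (ε / 2) :=
  Real.rpow_le_rpow_of_exponent_le hΔ (by linarith)

/-- The same bound for `g ∈ U(1,1)` itself. -/
theorem Delta_rpow_exponent_bound (hg : MemU11 g) {r ε : ℝ} (hr : 1 / 2 - ε ≤ r) :
    (Delta g).re ^ (-(r - 1 / 2) / 2) ≤ (Delta g).re ^ (ε / 2) :=
  rpow_exponent_bound (one_le_Delta_re hg) hr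

/-- `|a(i(g,1))|^x = Δ(g)^(−x/2)` for every real exponent `x` (the dictionary between the two
normalisations used in (N4.3.P1)). -/
theorem aNorm_rpow (hg : MemU11 g) (x : ℝ) : aNorm g ^ x = (Delta g).re ^ (-x / 2) := by
  unfold aNorm
  rw [← Real.rpow_mul (by linarith [one_le_Delta_re hg])]
  congr 1; ring

end bound

section hyperbolic

/-- The complexified hyperbolic matrix `a_t = [[cosh t, sinh t], [sinh t, cosh t]]`. -/
noncomputable def hyperbolicC (t : ℝ) : Matrix (Fin 2) (Fin 2) ℂ :=
  !![(Real.cosh t : ℂ), (Real.sinh t : ℂ); (Real.sinh t : ℂ), (Real.cosh t : ℂ)]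

/-- `a_t ∈ U(1,1)`. -/
lemma hyperbolicC_memU11 (t : ℝ) : MemU11 (hyperbolicC t) := by
  have h' : ((Real.cosh t : ℝ) : ℂ) ^ 2 - ((Real.sinh t : ℝ) : ℂ) ^ 2 = 1 := by
    have h := congrArg (fun x : ℝ => (x : ℂ)) (Real.cosh_sq_sub_sinh_sq t)
    simpa only [Complex.ofReal_sub, Complex.ofReal_pow, Complex.ofReal_one] using h
  unfold MemU11
  ext i j
  fin_cases i <;> fin_cases j <;>
    simp only [hyperbolicC, J, Matrix.mul_apply, Fin.sum_univ_two, Matrix.conjTranspose_apply,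
      Complex.star_def, Matrix.of_apply, Matrix.cons_val', Matrix.cons_val_zero, Matrix.cons_val_one,
      Matrix.empty_val', Matrix.cons_val_fin_one, Complex.conj_ofReal,
      Fin.zero_eta, Fin.mk_one, Fin.isValue] <;>
    first
      | linear_combination h'
      | linear_combination (-1 : ℂ) * h'
      | linear_combination (0 : ℂ) * h'

/-- Consistency with kernel row L2 (`T5DoublingBlock.det_half_one_add_hyperbolic`): the general
identity returns `Δ(a_t) = cosh² t`. -/
theorem Delta_hyperbolicC (t : ℝ) : Delta (hyperbolicC t) = (Real.cosh t : ℂ) ^ 2 := by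
  rw [Delta_eq (hyperbolicC_memU11 t)]
  have h' : ((Real.cosh t : ℝ) : ℂ) ^ 2 = ((Real.sinh t : ℝ) : ℂ) ^ 2 + 1 := by
    have h := congrArg (fun x : ℝ => (x : ℂ)) (Real.cosh_sq t)
    simpa only [Complex.ofReal_add, Complex.ofReal_pow, Complex.ofReal_one] using h
  simp only [hyperbolicC, Matrix.of_apply, Matrix.cons_val', Matrix.cons_val_one,
    Matrix.cons_val_zero, Matrix.empty_val', Matrix.cons_val_fin_one, Complex.normSq_ofReal,
    Complex.ofReal_mul]
  linear_combination (-1 : ℂ) * h'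

end hyperbolic

section compactPlace

variable {g : Matrix (Fin 2) (Fin 2) ℂ}

/-- The compact place `τ′₁` (signature `(0,2)`, `U(W)(ℝ) = U(2)`): for a unitary `g` (no `U(1,1)`
hypothesis) `Δ(g) = 1`, so `|a(i(g,1))| = 1` identically there — the trivial case of the CLAIM. -/
theorem Delta_eq_one_of_mul_conjTranspose_eq_one (h : g * gᴴ = 1) : Delta g = 1 := by
  unfold Delta
  rw [h]
  have : (1 / 2 : ℂ) • ((1 : Matrix (Fin 2) (Fin 2) ℂ) + 1) = 1 := by
    ext i j; simp [Matrix.one_apply]; split_ifs <;> norm_num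
  rw [this, Matrix.det_one]

/-- The symmetrised form of the identity: `Δ(g) = 1 + (|g₀₁|² + |g₁₀|²)/2` on `U(1,1)`. -/
theorem Delta_eq_symm (hg : MemU11 g) :
    Delta g = 1 + ((normSq (g 0 1) + normSq (g 1 0)) / 2 : ℝ) := by
  rw [Delta_eq hg, normSq_offdiag hg]; push_cast; ring

/-- `Δ(g) ≥ 1 + |g₁₀|²` is an equality, so `Δ(g) > 1` exactly off `K_W`. -/
theorem one_lt_Delta_re_iff (hg : MemU11 g) : 1 < (Delta g).re ↔ ¬ g * gᴴ = 1 := by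
  rw [← Delta_eq_one_iff_mul_conjTranspose hg]
  have h1 := one_le_Delta_re hg
  have him := Delta_im hg
  constructor
  · intro hlt heq
    rw [heq, Complex.one_re] at hlt
    exact lt_irrefl _ hlt
  · intro hne
    rcases lt_or_eq_of_le h1 with hlt | heq
    · exact hlt
    · exact absurd (Complex.ext heq.symm (by rw [him]; simp)) hne

end compactPlace

end Summit.Ventures.HodgeRepro2.T5UnitaryBound
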